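import Literature.AnabelianGeometry.SemiGraphs.TemperedAnabelian
import Literature.AnabelianGeometry.SemiGraphs.TemperedCurves

/-!
# Bridge: the curve-level interface `TemperedCurve p` → the group-level interface `TemperedArithmeticGroup K`

Cell abc-iut, layer L3, ruling η (4) / η′ (4′) of abc-iut-L3-lead (2026-08-25): [SemiAnbd] §6's
curve-level interface `TemperedCurve p` (file `TemperedAnabelian.lean`: `K` a finite-dimensional
`IntermediateField ℚ_[p] (AlgebraicClosure ℚ_[p])`, `G_K = K.fixingSubgroup ≤ Gal(ℚ̄_p/ℚ_p)`,
`Π^temp_{X_K}`, its augmentation, profinite completion and decomposition groups) and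
[SemiAnbd] Example 3.10's group-level interface `TemperedArithmeticGroup K` (file
`TemperedCurves.lean`, seat abc-iut-L3-t2: `K` a bare field, `aug : Π → Field.absoluteGaloisGroup K`
surjective, `Π` and `Δ` tempered and temp-slim, `Π` Galois-countable) describe the same object
`π₁^temp(X_K)` ([SemiAnbd] §6 p. 69 / Ex. 3.10 p. 43).  This file DEFINES the passage
`TemperedCurve.toTemperedArithmeticGroup`; through it every group-level statement of the §3–§5
chain applies to a curve-level datum.

What `TemperedCurve p` does not assert but `TemperedArithmeticGroup` requires is supplied as an
explicit PARAMETER bundle `TemperedCurve.GroupLevelData X` — no named fact, nothing asserted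
(ruling η′: "parameters, never named facts, never sorry"):
* `galEquiv : X.GK ≃ₜ* Field.absoluteGaloisGroup X.K` — the identification of
  `Gal(ℚ̄_p/ℚ_p) ⊇ Fix(K) = Gal(ℚ̄_p/K)` with the absolute Galois group of the FIELD `K` computed from
  its own algebraic closure (a piece of infinite Galois theory to be discharged from Mathlib; cell
  item DISCHARGE-L3 §G G11, `FixingSubgroupAbsoluteGalois.lean`);
* "`Π` and `Δ` are tempered" (Def. 3.1 (i)), "temp-slim" (Ex. 3.10 p. 45), "Galois-countable"
  ([IUTchI] Rmk. 2.5.3 (i) (T1)) — printed properties of `π₁^temp(X_K)` that the §6 interface did not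
  need and therefore does not carry.
Everything else (`Π := Π^temp_{X_K}`, the augmentation composed with `galEquiv`, its surjectivity)
is constructed / PROVED here from `range_aug : aug.range = G_K`.

[cite: MochizukiSemiAnbd2006, §6 p.69]  No statement of the paper is involved beyond the two
interface descriptions; nothing here takes a side on [IUTchIII] Cor. 3.12.
-/

noncomputable section

namespace Literature.AnabelianGeometry.SemiGraphs

open Literature.AlgebraicGeometry.Frobenioids (IsSlimGroup)

namespace TemperedCurve

variable {p : ℕ} [Fact p.Prime]

/-- The augmentation of `Π^temp_{X_K}` with values in `G_K = Fix(K) ≤ Gal(ℚ̄_p/ℚ_p)` (range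
restriction of `aug` along `range_aug`). [cite: MochizukiSemiAnbd2006, §6 p.69] -/
def augGK (X : TemperedCurve p) : X.PiTemp →ₜ* X.GK where
  toMonoidHom := X.aug.toMonoidHom.codRestrict X.GK fun g => by
    change X.aug g ∈ X.K.fixingSubgroup
    rw [← X.range_aug]
    exact ⟨g, rfl⟩
  continuous_toFun := X.aug.continuous.subtype_mk _

/-- `augGK` followed by the inclusion is `aug`. [cite: MochizukiSemiAnbd2006, §6 p.69] -/
@[simp] theorem coe_augGK_apply (X : TemperedCurve p) (g : X.PiTemp) :
    ((X.augGK g : X.GK) : GQp p) = X.aug g := rfl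

/-- `augGK` is surjective ("`1 → Δ^temp_X → Π^temp_{X_K} → G_K → 1`" is exact on the right, p. 69).
[cite: MochizukiSemiAnbd2006, §6 p.69] -/
theorem augGK_surjective (X : TemperedCurve p) : Function.Surjective X.augGK := by
  intro h
  have hmem : (h : GQp p) ∈ X.aug.toMonoidHom.range := by
    rw [X.range_aug]; exact h.2
  obtain ⟨g, hg⟩ := hmem
  exact ⟨g, Subtype.ext hg⟩

/-- The augmentation with values in the absolute Galois group of the field `K`, through an
identification `ι : G_K ≃ Gal(K̄/K)`. [cite: MochizukiSemiAnbd2006, §6 p.69] -/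
def augK (X : TemperedCurve p) (ι : X.GK ≃ₜ* Field.absoluteGaloisGroup X.K) :
    X.PiTemp →ₜ* Field.absoluteGaloisGroup X.K where
  toMonoidHom := ι.toMulEquiv.toMonoidHom.comp X.augGK.toMonoidHom
  continuous_toFun := ι.continuous.comp X.augGK.continuous

/-- `augK ι` is surjective. [cite: MochizukiSemiAnbd2006, §6 p.69] -/
theorem augK_surjective (X : TemperedCurve p) (ι : X.GK ≃ₜ* Field.absoluteGaloisGroup X.K) :
    Function.Surjective (X.augK ι) :=
  ι.surjective.comp X.augGK_surjective

/-- The kernel of `augK ι` is `Δ^temp_X = ker aug` (`ι` is injective).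
[cite: MochizukiSemiAnbd2006, §6 p.69] -/
theorem ker_augK (X : TemperedCurve p) (ι : X.GK ≃ₜ* Field.absoluteGaloisGroup X.K) :
    (X.augK ι).toMonoidHom.ker = X.DeltaTemp := by
  ext g
  simp only [MonoidHom.mem_ker]
  change ι (X.augGK g) = 1 ↔ g ∈ X.aug.toMonoidHom.ker
  rw [← map_one ι, ι.apply_eq_iff_eq, MonoidHom.mem_ker]
  constructor
  · intro h
    have := congrArg (fun x : X.GK => (x : GQp p)) h
    simpa using this
  · intro h
    exact Subtype.ext (by simpa using h)

/-- The explicit PARAMETER bundle of the bridge (ruling η′: parameters, never named facts): what the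
group-level interface `TemperedArithmeticGroup X.K` requires and the curve-level datum `X` does not
assert — the identification `G_K ≃ Gal(K̄/K)` of infinite Galois theory (discharge item G11), and
the printed properties "`Π`, `Δ` tempered" ([SemiAnbd] Def. 3.1 (i), Ex. 3.10 p. 43), "`Π`, `Δ`
temp-slim" (Ex. 3.10 p. 45), "`Π` Galois-countable" ([IUTchI] Rmk. 2.5.3 (i) (T1)).
[cite: MochizukiSemiAnbd2006, Ex 3.10 pp.43-45] -/
structure GroupLevelData (X : TemperedCurve p) : Type where
  /-- `G_K = Fix(K) ≤ Gal(ℚ̄_p/ℚ_p)` identified with `Gal(K̄/K)` of the field `K` -/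
  galEquiv : X.GK ≃ₜ* Field.absoluteGaloisGroup X.K
  /-- "`Π^temp_{X_K}` is a tempered topological group" -/
  isTempered : IsTempered X.PiTemp
  /-- "`Δ^temp_X` is also tempered" -/
  isTempered_ker : IsTempered (X.augK galEquiv).toMonoidHom.ker
  /-- "`Π` is temp-slim" -/
  isSlimGroup : IsSlimGroup X.PiTemp
  /-- "`Δ` is temp-slim" -/
  isSlimGroup_ker : IsSlimGroup (X.augK galEquiv).toMonoidHom.ker
  /-- "`Π` is Galois-countable" -/
  secondCountableTopology : SecondCountableTopology X.PiTemp

/-- **The bridge** (ruling η (4) / η′ (4′) of abc-iut-L3-lead): a curve-level datum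
`X : TemperedCurve p` together with the parameter bundle `d` yields the group-level datum
`TemperedArithmeticGroup X.K` of [SemiAnbd] Example 3.10 with `Π := Π^temp_{X_K}` and augmentation
`ι ∘ aug : Π^temp_{X_K} → G_K ≅ Gal(K̄/K)`. [cite: MochizukiSemiAnbd2006, Ex 3.10 p.43] -/
def toTemperedArithmeticGroup (X : TemperedCurve p) (d : X.GroupLevelData) :
    TemperedArithmeticGroup X.K where
  Pi := X.PiTemp
  isTempered := d.isTempered
  aug := X.augK d.galEquiv
  aug_surjective := X.augK_surjective d.galEquiv
  isTempered_ker := d.isTempered_ker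
  isSlimGroup := d.isSlimGroup
  isSlimGroup_ker := d.isSlimGroup_ker
  secondCountableTopology := d.secondCountableTopology

/-- The bridge does not change the group: `(X.toTemperedArithmeticGroup d).Pi = Π^temp_{X_K}`.
[cite: MochizukiSemiAnbd2006, Ex 3.10 p.43] -/
@[simp] theorem toTemperedArithmeticGroup_Pi (X : TemperedCurve p) (d : X.GroupLevelData) :
    (X.toTemperedArithmeticGroup d).Pi = X.PiTemp := rfl

/-- Under the bridge, t2's `Δ = ker aug` is the §6 `Δ^temp_X`. [cite: MochizukiSemiAnbd2006, §6 p.69] -/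
theorem toTemperedArithmeticGroup_delta (X : TemperedCurve p) (d : X.GroupLevelData) :
    (X.toTemperedArithmeticGroup d).delta = X.DeltaTemp :=
  X.ker_augK d.galEquiv

end TemperedCurve

end Literature.AnabelianGeometry.SemiGraphs

end
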